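import Summits.HodgeConjecture.HodgeConjecture.Theorems.F0P3CotangentFormValueMap      -- ★ B1′ (F0P3-p01 (g3)): `valueMap_hol`; ★ `exists_valueMap`, `valueMap_apply_upqUnit`, `upqUnit_apply_inl_inr`
import Literature.RepresentationTheory.BorelWallach2000.TrivialModuleGKCohomologyUnitary   -- ★ `upq_fromBlocks_mem_lie_iff`, `upq_mem_kInLie_iff_blocks`
import Literature.NumberTheory.Automorphic.GKModulesOneParameter                        -- ★ `IsGKModule.apply_mem_of_expK_stable`
import HarnessLib

/-!
# Crux `H413` — RUNG 1½ «ISOTYPY FROM A NULL CORE», brick B4e: the cotangent `K`-type is IRREDUCIBLE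
# (the span of the two coordinate classes of a holomorphic cotangent form has no `K`-stable subspace other than `⊥` and itself)

Floor-0 programme P3 «U3-mult», seat F0P3-p03 (g4); crux item stmt-HodgeConjecture-24833 (`HCCMUnconditional.H413`); rung-1 line
`Cruxes/H413/Lines/F0_U3LettersRung1.lean` ed. 2.1, stub `stub_F1a_cm : StubF1aCM`; road «F1a in-house at the pin» (F0P3-p02 (g3),
`F0/P3/F0P3-p02/ROAD-F1a-inhouse.F0P3p02g3.md`, step B4b (ii) «`E` `K`-irreducible (`hEirr`): cotangent `K`-type `τ` irreducible — small lemma»).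
This file DISCHARGES the residual binder `hEirr` of F0P3-p02 (g3)'s CM assembly `F0P3HolFormArchIsotypy.archIsotypy_of_hol` (B5c, rf 302ceb79 :270–300,
GO 2026-08-31T02:25:39Z), stated here as the conclusion of `hEirr_cm` TOKEN FOR TOKEN.  HC_CM is proved only modulo the printed citations until rung 0 closes.

THE MATHEMATICS ([BorelWallach2000, II §4.1–4.2, VI 4.8 (3)]; [KnappVogan1995, §I.3]; [Rogawski1990, Prop. 15.2.1 (b)]).  Let `(ρK, ρ𝔤)` be a
`(𝔤, K)`-module of `U(2,1)_{Fin 2 ⊕ Fin 1} = uFormGroup (Fin 2) (Fin 1)` and `v₀, v₁ ∈ V` the frame vectors of a TYPED VALUE MAP `φ : 𝔤 → V`,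
`φ(Y) = Σⱼ Y_{(inl j)(inr 0)} vⱼ`, which is `𝔨`-EQUIVARIANT: `φ ⁅W, X⁆ = ρ𝔤 W (φ X)` for `W ∈ 𝔨` (conclusion (h𝔨) of ★ B1′
`F0P3CotangentFormValueMap.valueMap_hol` for the coordinate classes of a holomorphic cotangent form).  Then `𝔨 = 𝔲(2) ⊕ 𝔲(1)` acts on the frame by
`ρ𝔤 (diag(A, 0)) vⱼ = Σᵢ A_{ij} vᵢ` for every skew-Hermitian `A ∈ 𝔲(2)` (§1 `lie_apply_frame_of_coe_eq`: `vⱼ = φ(X_{E_{j0}})` and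
`⁅diag(A,0), X⁆_{(inl i)(inr 0)} = Σ_{i'} A_{i i'} X_{(inl i')(inr 0)}`) — the standard representation of `𝔲(2)` on `ℂ²`, which is irreducible: with
`A₁ = diag(i, 0)` and `A₂ = [[0, 1], [−1, 0]]`, `ρ𝔤(W₁)(c₀v₀ + c₁v₁) = i c₀ v₀`, `ρ𝔤(W₂) v₀ = −v₁`, `ρ𝔤(W₂) v₁ = v₀`, so a non-zero `𝔨`-stable
`F ≤ span {v₀, v₁}` contains `v₀` and `v₁`.  A `K`-STABLE subspace is `𝔨`-stable (★ `IsGKModule.apply_mem_of_expK_stable`: the weak derivative of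
`t ↦ ρK (exp tW) f ∈ F`), whence **`eq_bot_or_eq_span_of_K_stable`**: every `K`-stable `F ≤ span {v₀, v₁}` is `⊥` or `span {v₀, v₁}` — the `hEirr`
binder of ★ B1 `F0P3GenIrreducibleOfUnitary.eq_bot_or_eq_gen_of_isGKSubmodule`.  §2 specialises to the CM pin: for a discrete automorphic `P` of
`U(H)` and `Φ ∈ holCotForms` (compact quotient: `hdef`, `h2`), every choice of coordinate classes `v₀, v₁ ∈ P.archModuleCM ι T hT` (★ `exists_vectors`)
spans a `K`-irreducible subspace: **`hEirr_cm`**, whose conclusion is the `hEirr` binder of `archIsotypy_of_hol` verbatim.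

* §1 (generic) `kInLie_apply_mem_of_K_stable`, `fromBlocks_mem_lie`, `mem_kInLie_of_coe_eq`, `lie_apply_inl_inr_of_coe_eq`, `lie_apply_frame_of_coe_eq`,
  **`eq_bot_or_eq_span_of_K_stable`**.
* §2 (CM pin) **`hEirr_cm`**.

No definition, no sorry, no named fact; `--supports stmt-HodgeConjecture-24833`.

References: [BorelWallach2000] A. Borel, N. Wallach, 2nd ed. (2000), II §4.1–4.2, VI 4.8 (3); [KnappVogan1995] A. Knapp, D. Vogan (1995), §I.3;
[Rogawski1990] J. Rogawski, Ann. of Math. Stud. 123, Prop. 15.2.1 (b).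
-/

-- Mathlib idiom (as in ★ `GKModules`, the T6 layer, B1 and B1′): commutator bracket on `Module.End` ∕ matrices
attribute [local instance 100] LieRing.ofAssociativeRing

set_option autoImplicit false
-- the mandated namespace repeats `HodgeConjecture.HodgeConjecture`, as in every `Theorems/*.lean` of this sub-problem
set_option linter.dupNamespace false

noncomputable section

open scoped Matrix MatrixGroups ComplexConjugate ENNReal ComplexOrder
open MeasureTheory NumberField

namespace Summit.HodgeConjecture.HodgeConjecture.Cruxes.H413.F0P3HolFormKType

open Literature.NumberTheory.Automorphic Literature.NumberTheory.Automorphic.UnitaryGroup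
open Literature.NumberTheory.Automorphic.UnitaryGroup.CotangentForms
open Literature.RepresentationTheory.KonnoKonno2007 Literature.RepresentationTheory.KonnoKonno2007.RealDualPair
open Literature.RepresentationTheory.KonnoKonno2007.RealDualPair.UForm
open Literature.RepresentationTheory.BorelWallach2000
open Literature.Geometry.ComplexHyperbolic.BallModel (J)
open Summit.HodgeConjecture.HodgeConjecture.Cruxes.H413.F0P3CMFrameOrbit (upqUnit_apply_inl_inr)
open Summit.HodgeConjecture.HodgeConjecture.Cruxes.H413.F0P3ValueMapOfFrameVectors (exists_valueMap valueMap_apply_upqUnit)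
open Summit.HodgeConjecture.HodgeConjecture.Cruxes.H413.F0P3CotangentFormL2Span (memLp_toQuotFun_apply)
open Summit.HodgeConjecture.HodgeConjecture.Cruxes.H413.F0P3CotangentFormValueMap (valueMap_hol)
open Summit.HodgeConjecture.HodgeConjecture.Cruxes.H413.F0P3HolProjectionReduction (compactSpace_automorphicQuotient_cm)

/-! ## §1 (generic) The span of the frame vectors of a `𝔨`-equivariant value map is `K`-irreducible -/

section Generic

variable {α β : Type} [Fintype α] [DecidableEq α] [Fintype β] [DecidableEq β]
variable {V : Type} [AddCommGroup V] [Module ℂ V]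

/-- **A `K`-stable subspace of a `(𝔤, K)`-module is `𝔨`-stable** (weak derivative of `t ↦ ρK (exp tW) u ∈ U`, ★ `IsGKModule.apply_mem_of_expK_stable`).
[cite: BorelWallach2000, 0 §2.4] [cite: KnappVogan1995, §I.3] -/
theorem kInLie_apply_mem_of_K_stable {ρK : Representation ℂ (uFormGroup α β).maximalCompact V} {ρ𝔤 : (uFormGroup α β).lie →ₗ⁅ℝ⁆ Module.End ℂ V}
    (hGK : IsGKModule (uFormGroup α β) ρK ρ𝔤) {W : (uFormGroup α β).lie} (hW : W ∈ (uFormGroup α β).kInLie) {U : Submodule ℂ V}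
    (hK : ∀ (k : (uFormGroup α β).maximalCompact), ∀ u ∈ U, ρK k u ∈ U) {u : V} (hu : u ∈ U) : ρ𝔤 W u ∈ U := by
  have hWc : (W : Matrix (α ⊕ β) (α ⊕ β) ℂ) ∈ (uFormGroup α β).compactLie := ((uFormGroup α β).mem_kInLie_iff W).1 hW
  have heq : LieSubalgebra.inclusion (uFormGroup α β).compactLie_le_lie ⟨_, hWc⟩ = W := rfl
  have h := hGK.apply_mem_of_expK_stable ⟨_, hWc⟩ (U := U) (fun t u hu => hK _ u hu) hu
  rwa [heq] at h

variable {ρK : Representation ℂ (uFormGroup (Fin 2) (Fin 1)).maximalCompact V} {ρ𝔤 : (uFormGroup (Fin 2) (Fin 1)).lie →ₗ⁅ℝ⁆ Module.End ℂ V}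

/-- `diag(A, 0) ∈ 𝔲(2,1)` for `A` skew-Hermitian (★ `upq_fromBlocks_mem_lie_iff`). [cite: BorelWallach2000, II §4.1] -/
theorem fromBlocks_mem_lie {A : Matrix (Fin 2) (Fin 2) ℂ} (hA : Aᴴ = -A) :
    Matrix.fromBlocks A 0 0 (0 : Matrix (Fin 1) (Fin 1) ℂ) ∈ (uFormGroup (Fin 2) (Fin 1)).lie :=
  (upq_fromBlocks_mem_lie_iff A 0 0 0).2 ⟨hA, by rw [Matrix.conjTranspose_zero, neg_zero], by rw [Matrix.conjTranspose_zero]⟩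

/-- `diag(A, 0) ∈ 𝔨` (its off-diagonal block vanishes, ★ `upq_mem_kInLie_iff_blocks`). [cite: BorelWallach2000, II §4.1] -/
theorem mem_kInLie_of_coe_eq {A : Matrix (Fin 2) (Fin 2) ℂ} (W : (uFormGroup (Fin 2) (Fin 1)).lie)
    (hW : (W : Matrix (Fin 2 ⊕ Fin 1) (Fin 2 ⊕ Fin 1) ℂ) = Matrix.fromBlocks A 0 0 0) : W ∈ (uFormGroup (Fin 2) (Fin 1)).kInLie := by
  rw [upq_mem_kInLie_iff_blocks, hW, Matrix.toBlocks_fromBlocks₁₂]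

/-- **`⁅diag(A, 0), X⁆_{(inl i)(inr 0)} = Σ_{i'} A_{i i'} X_{(inl i')(inr 0)}`** (the upper-right column of the bracket). [cite: BorelWallach2000, II §4.1] -/
theorem lie_apply_inl_inr_of_coe_eq {A : Matrix (Fin 2) (Fin 2) ℂ} (W : (uFormGroup (Fin 2) (Fin 1)).lie)
    (hW : (W : Matrix (Fin 2 ⊕ Fin 1) (Fin 2 ⊕ Fin 1) ℂ) = Matrix.fromBlocks A 0 0 0) (X : (uFormGroup (Fin 2) (Fin 1)).lie) (i : Fin 2) :
    ((⁅W, X⁆ : (uFormGroup (Fin 2) (Fin 1)).lie) : Matrix (Fin 2 ⊕ Fin 1) (Fin 2 ⊕ Fin 1) ℂ) (Sum.inl i) (Sum.inr 0) =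
      ∑ i' : Fin 2, A i i' * (X : Matrix (Fin 2 ⊕ Fin 1) (Fin 2 ⊕ Fin 1) ℂ) (Sum.inl i') (Sum.inr 0) := by
  rw [LieSubalgebra.coe_bracket, Ring.lie_def, Matrix.sub_apply, Matrix.mul_apply, Matrix.mul_apply, hW,
    Fintype.sum_sum_type, Fintype.sum_sum_type]
  simp [Matrix.fromBlocks_apply₁₁, Matrix.fromBlocks_apply₁₂, Matrix.fromBlocks_apply₂₂]

/-- **`𝔨` acts on the frame of a `𝔨`-equivariant typed value map through the standard representation**: `ρ𝔤 (diag(A, 0)) vⱼ = Σᵢ A_{ij} vᵢ`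
(`vⱼ = φ (X_{E_{j0}})`, ★ `valueMap_apply_upqUnit`, and `φ ⁅W, X⁆ = ρ𝔤 W (φ X)`). [cite: BorelWallach2000, VI 4.8 (3); II §4.2] -/
theorem lie_apply_frame_of_coe_eq (v : Fin 2 → V) (φ : (uFormGroup (Fin 2) (Fin 1)).lie →ₗ[ℝ] V)
    (hφ : ∀ Y : (uFormGroup (Fin 2) (Fin 1)).lie,
      φ Y = ∑ j : Fin 2, ((Y : Matrix (Fin 2 ⊕ Fin 1) (Fin 2 ⊕ Fin 1) ℂ) (Sum.inl j) (Sum.inr 0)) • v j)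
    (hk : ∀ W ∈ (uFormGroup (Fin 2) (Fin 1)).kInLie, ∀ X : (uFormGroup (Fin 2) (Fin 1)).lie, φ ⁅W, X⁆ = ρ𝔤 W (φ X))
    {A : Matrix (Fin 2) (Fin 2) ℂ} (W : (uFormGroup (Fin 2) (Fin 1)).lie)
    (hW : (W : Matrix (Fin 2 ⊕ Fin 1) (Fin 2 ⊕ Fin 1) ℂ) = Matrix.fromBlocks A 0 0 0) (j : Fin 2) :
    ρ𝔤 W (v j) = ∑ i : Fin 2, A i j • v i := by
  have hφ' : ∀ Y : (uFormGroup (Fin 2) (Fin 1)).lie, φ Y = ∑ j : Fin 2,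
      LinearMap.id (R := ℝ) ((Y : Matrix (Fin 2 ⊕ Fin 1) (Fin 2 ⊕ Fin 1) ℂ) (Sum.inl j) (Sum.inr 0)) • v j := hφ
  have hX : φ (upqUnit (j, (0 : Fin 1)) 1) = v j := by
    rw [valueMap_apply_upqUnit LinearMap.id v φ hφ' (j, 0) 1, LinearMap.id_apply, one_smul]
  rw [← hX, ← hk W (mem_kInLie_of_coe_eq W hW), hφ]
  refine Finset.sum_congr rfl fun i _ => ?_
  rw [lie_apply_inl_inr_of_coe_eq W hW _ i, Finset.sum_eq_single j]
  · rw [upqUnit_apply_inl_inr, if_pos rfl, mul_one]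
  · intro i' _ hi'
    rw [upqUnit_apply_inl_inr, if_neg hi', mul_zero]
  · exact fun h => absurd (Finset.mem_univ _) h

/-- **The span of the frame of a `𝔨`-equivariant typed value map is `K`-IRREDUCIBLE**: in a `(𝔤, K)`-module of `U(2,1)_{Fin 2 ⊕ Fin 1}`, every `K`-stable
`F ≤ span {v₀, v₁}` is `⊥` or `span {v₀, v₁}` (the `hEirr` binder of ★ B1 `eq_bot_or_eq_gen_of_isGKSubmodule`).  `K`-stable ⇒ `𝔨`-stable; `W₁ = diag(i, 0, 0)`
sends `c₀v₀ + c₁v₁` to `i c₀ v₀` and `W₂ = [[0,1],[−1,0]] ⊕ 0` swaps the frame up to sign, so a non-zero such `F` contains `v₀` and `v₁`.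
[cite: BorelWallach2000, II §4.1–4.2; VI 4.8 (3)] [cite: KnappVogan1995, §I.3] [cite: Rogawski1990, Prop. 15.2.1 (b)] -/
theorem eq_bot_or_eq_span_of_K_stable (hGK : IsGKModule (uFormGroup (Fin 2) (Fin 1)) ρK ρ𝔤) (v : Fin 2 → V)
    (φ : (uFormGroup (Fin 2) (Fin 1)).lie →ₗ[ℝ] V)
    (hφ : ∀ Y : (uFormGroup (Fin 2) (Fin 1)).lie,
      φ Y = ∑ j : Fin 2, ((Y : Matrix (Fin 2 ⊕ Fin 1) (Fin 2 ⊕ Fin 1) ℂ) (Sum.inl j) (Sum.inr 0)) • v j)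
    (hk : ∀ W ∈ (uFormGroup (Fin 2) (Fin 1)).kInLie, ∀ X : (uFormGroup (Fin 2) (Fin 1)).lie, φ ⁅W, X⁆ = ρ𝔤 W (φ X))
    (F : Submodule ℂ V) (hF : F ≤ Submodule.span ℂ (Set.range v))
    (hFK : ∀ (k : (uFormGroup (Fin 2) (Fin 1)).maximalCompact), ∀ f ∈ F, ρK k f ∈ F) :
    F = ⊥ ∨ F = Submodule.span ℂ (Set.range v) := by
  -- the two elements `W₁ = diag(i, 0) ⊕ 0` and `W₂ = [[0, 1], [-1, 0]] ⊕ 0` of `𝔨`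
  have hA₁ : (!![Complex.I, 0; 0, 0] : Matrix (Fin 2) (Fin 2) ℂ)ᴴ = -!![Complex.I, 0; 0, 0] := by
    ext i j
    fin_cases i <;> fin_cases j <;> simp [Matrix.conjTranspose_apply]
  have hA₂ : (!![0, 1; -1, 0] : Matrix (Fin 2) (Fin 2) ℂ)ᴴ = -!![0, 1; -1, 0] := by
    ext i j
    fin_cases i <;> fin_cases j <;> simp [Matrix.conjTranspose_apply]
  set W₁ : (uFormGroup (Fin 2) (Fin 1)).lie := ⟨_, fromBlocks_mem_lie hA₁⟩ with hW₁_def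
  set W₂ : (uFormGroup (Fin 2) (Fin 1)).lie := ⟨_, fromBlocks_mem_lie hA₂⟩ with hW₂_def
  have hW₁ : (W₁ : Matrix (Fin 2 ⊕ Fin 1) (Fin 2 ⊕ Fin 1) ℂ) = Matrix.fromBlocks !![Complex.I, 0; 0, 0] 0 0 0 := rfl
  have hW₂ : (W₂ : Matrix (Fin 2 ⊕ Fin 1) (Fin 2 ⊕ Fin 1) ℂ) = Matrix.fromBlocks !![0, 1; -1, 0] 0 0 0 := rfl
  -- their action on the frame
  have h10 : ρ𝔤 W₁ (v 0) = Complex.I • v 0 := by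
    rw [lie_apply_frame_of_coe_eq v φ hφ hk W₁ hW₁ 0, Fin.sum_univ_two]; simp
  have h11 : ρ𝔤 W₁ (v 1) = 0 := by
    rw [lie_apply_frame_of_coe_eq v φ hφ hk W₁ hW₁ 1, Fin.sum_univ_two]; simp
  have h20 : ρ𝔤 W₂ (v 0) = -v 1 := by
    rw [lie_apply_frame_of_coe_eq v φ hφ hk W₂ hW₂ 0, Fin.sum_univ_two]; simp
  have h21 : ρ𝔤 W₂ (v 1) = v 0 := by
    rw [lie_apply_frame_of_coe_eq v φ hφ hk W₂ hW₂ 1, Fin.sum_univ_two]; simp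
  -- `F` is stable under `W₁`, `W₂`
  have hF₁ : ∀ f ∈ F, ρ𝔤 W₁ f ∈ F := fun f hf => kInLie_apply_mem_of_K_stable hGK (mem_kInLie_of_coe_eq W₁ hW₁) hFK hf
  have hF₂ : ∀ f ∈ F, ρ𝔤 W₂ f ∈ F := fun f hf => kInLie_apply_mem_of_K_stable hGK (mem_kInLie_of_coe_eq W₂ hW₂) hFK hf
  rcases eq_or_ne F ⊥ with h0 | h0
  · exact Or.inl h0
  right
  refine le_antisymm hF ?_
  obtain ⟨f, hfF, hf0⟩ := (Submodule.ne_bot_iff F).1 h0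
  obtain ⟨c, hc⟩ := (Submodule.mem_span_range_iff_exists_fun ℂ).1 (hF hfF)
  rw [Fin.sum_univ_two] at hc
  -- `v₀ ∈ F` and `v₁ ∈ F`
  have key : v 0 ∈ F ∧ v 1 ∈ F := by
    have h1 : ρ𝔤 W₁ f = (c 0 * Complex.I) • v 0 := by
      rw [← hc, map_add, map_smul, map_smul, h10, h11, smul_zero, add_zero, smul_smul]
    by_cases hc0 : c 0 = 0
    · have hf : f = c 1 • v 1 := by rw [← hc, hc0, zero_smul, zero_add]
      have hc1 : c 1 ≠ 0 := by
        rintro h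
        exact hf0 (by rw [hf, h, zero_smul])
      have hv1 : v 1 ∈ F := by
        have h := Submodule.smul_mem F (c 1)⁻¹ hfF
        rwa [hf, smul_smul, inv_mul_cancel₀ hc1, one_smul] at h
      have hv0 : v 0 ∈ F := by
        have h := hF₂ _ hv1
        rwa [h21] at h
      exact ⟨hv0, hv1⟩
    · have hv0 : v 0 ∈ F := by
        have hmem : (c 0 * Complex.I) • v 0 ∈ F := h1 ▸ hF₁ f hfF
        have hne : c 0 * Complex.I ≠ 0 := mul_ne_zero hc0 Complex.I_ne_zero
        have h := Submodule.smul_mem F (c 0 * Complex.I)⁻¹ hmem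
        rwa [smul_smul, inv_mul_cancel₀ hne, one_smul] at h
      have hv1 : v 1 ∈ F := by
        have h := hF₂ _ hv0
        rw [h20] at h
        exact (Submodule.neg_mem_iff F).1 h
      exact ⟨hv0, hv1⟩
  refine Submodule.span_le.2 ?_
  rintro _ ⟨j, rfl⟩
  fin_cases j
  exacts [key.1, key.2]

end Generic

/-! ## §2 The CM pin: the coordinate classes of a holomorphic cotangent form span a `K`-irreducible subspace of `P.archModuleCM` -/

variable {L : Type} [Field L] [NumberField L] [IsCMField L] (ι : L →+* ℂ) {H : Matrix (Fin 3) (Fin 3) L}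
  (T : GL (Fin 3) ℂ) (hT : (T : Matrix (Fin 3) (Fin 3) ℂ)ᴴ * H.map ι * (T : Matrix (Fin 3) (Fin 3) ℂ) = J)

/-- **The cotangent `K`-type at the CM pin is irreducible** — the residual binder `hEirr` of F0P3-p02 (g3)'s `F0P3HolFormArchIsotypy.archIsotypy_of_hol`
VERBATIM: for a discrete automorphic `P` of `U(H)(𝔸_{L⁺})` (CM frame `(L, ι, H, T, hT)`, `H` definite away from `ι`, `[L⁺ : ℚ] ≥ 2`, so the quotient is
compact) and `Φ ∈ holCotForms`, every choice `v` of coordinate classes of `Φ` in `P.archModuleCM ι T hT` spans a subspace all of whose `K`-stable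
subspaces are `⊥` or the whole span (§1 applied to the value map of ★ B1′ `valueMap_hol`, whose conclusion (h𝔨) is the `𝔨`-equivariance).
[cite: BorelWallach2000, II §4.1–4.2; VI 4.8 (3)] [cite: Rogawski1990, Prop. 15.2.1 (b)] [cite: BorelJacquetCorvallis1979, §4.6] -/
theorem hEirr_cm
    (hdef : ∀ τ' : L →+* ℂ, InfinitePlace.mk τ' ≠ InfinitePlace.mk ι → (H.map τ').PosDef) (h2 : 2 ≤ Module.finrank ℚ ↥(maximalRealSubfield L))
    (μ : Measure (adelicGroupData (↥(maximalRealSubfield L)) L (IsCMField.complexConj L) 3 H).automorphicQuotient)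
    [(adelicGroupData (↥(maximalRealSubfield L)) L (IsCMField.complexConj L) 3 H).IsAutomorphicMeasure μ]
    (P : DiscreteAutomorphicRep (adelicGroupData (↥(maximalRealSubfield L)) L (IsCMField.complexConj L) 3 H) μ)
    {Φ : (adelicGroupData (↥(maximalRealSubfield L)) L (IsCMField.complexConj L) 3 H).Adelic → (Fin 2 → ℂ)}
    (hΦ : Φ ∈ holCotForms (↥(maximalRealSubfield L)) L (IsCMField.complexConj L) 3 H (cmArchSection L ι H T hT) (cmCompactFactor L ι H T hT)) :
    ∀ v : Fin 2 → P.archModuleCM ι T hT,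
      (∀ j : Fin 2, ∃ hm : MemLp (toQuotFun (adelicGroupData (↥(maximalRealSubfield L)) L (IsCMField.complexConj L) 3 H) fun x => Φ x j) 2 μ,
        (((v j : P.archModuleCM ι T hT) : P.space.toSubmodule) : (adelicGroupData (↥(maximalRealSubfield L)) L (IsCMField.complexConj L) 3 H).L2 μ) =
          hm.toLp _) →
      ∀ F : Submodule ℂ (P.archModuleCM ι T hT), F ≤ Submodule.span ℂ (Set.range v) →
        (∀ (k : (uFormGroup (Fin 2) (Fin 1)).maximalCompact), ∀ f ∈ F, P.archRepKCM ι T hT k f ∈ F) → F = ⊥ ∨ F = Submodule.span ℂ (Set.range v) := by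
  haveI := compactSpace_automorphicQuotient_cm hdef h2 (L := L) (ι := ι) (H := H)
  intro v hv F hF hFK
  have hv' : ∀ j : Fin 2, (((v j : P.archModuleCM ι T hT) : P.space.toSubmodule) :
      (adelicGroupData (↥(maximalRealSubfield L)) L (IsCMField.complexConj L) 3 H).L2 μ) =
      (memLp_toQuotFun_apply ι T hT (μ := μ) hΦ j).toLp
        (toQuotFun (adelicGroupData (↥(maximalRealSubfield L)) L (IsCMField.complexConj L) 3 H) fun x => Φ x j) := by
    intro j
    obtain ⟨hm, h⟩ := hv j
    exact h
  obtain ⟨φ, hφ⟩ := exists_valueMap LinearMap.id v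
  have hφ' : ∀ Y : (uFormGroup (Fin 2) (Fin 1)).lie,
      φ Y = ∑ j : Fin 2, ((Y : Matrix (Fin 2 ⊕ Fin 1) (Fin 2 ⊕ Fin 1) ℂ) (Sum.inl j) (Sum.inr 0)) • v j := hφ
  obtain ⟨-, -, hk, -, -, -⟩ := valueMap_hol ι T hT P hΦ v hv' φ hφ'
  exact eq_bot_or_eq_span_of_K_stable (P.isGKModule_archModuleCM ι T hT) v φ hφ' hk F hF hFK

end Summit.HodgeConjecture.HodgeConjecture.Cruxes.H413.F0P3HolFormKType

end
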